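import Summits.BirchSwinnertonDyer.BirchSwinnertonDyer.Theorems.BiquadraticEisensteinDescentHeegnerTwistCouplingInSupplyThreeSquaresPinRankZero
import Summits.BirchSwinnertonDyer.BirchSwinnertonDyer.Theorems.BiquadraticEisensteinDescentHeegnerTwistCouplingInSupplySizeIndivisibleSharp
import Literature.NumberTheory.EllipticCurves.HeegnerFieldOfDiscriminantProofs
import Literature.NumberTheory.EllipticCurves.CongruentNumberCurveConductorSign
import Literature.NumberTheory.EllipticCurves.Kriz2020.GoldfeldJ1728Proofs
import Mathlib.Analysis.Real.Pi.Bounds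
import Mathlib.Analysis.Complex.ExponentialBounds
import Literature.NumberTheory.Sieve.MoebiusShiftedPrimesSieveBound
import HarnessLib

set_option linter.dupNamespace false -- `Summit.BirchSwinnertonDyer.BirchSwinnertonDyer.Theorems.…` (summit = sub)
set_option autoImplicit false

/-!
# Crux `HeegnerTwistCouplingInSupply` (stmt-BirchSwinnertonDyer-21381) — the card's corner theorems
# `CruxOnE2pCornerMod12`, `CruxOnEpCornerMod24` (card `three-squares-heegner-pin`) PROVED modulo five named facts

Route `BiquadraticEisensteinDescent` (cell `pub/bsd-wall`, row-12 line lead `bsd-line-ibd-p1` g10). The FIELD half on top of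
the `L`-half of p644288 (`…ThreeSquaresPinRankZero`): the witness Heegner field is `K′ = ℚ(√d)`, `d = −3ℓ` for the
three-squares pin `ℓ` — the tree's `sqrtField d` (`HeegnerFieldOfDiscriminantProofs`: imaginary quadratic, `d_{K′} = d`,
Heegner hypothesis from `d ≡ 1 (mod 8)` and `(d/q) = +1` at the odd primes `q ∣ N`), with `N(E_{2p}) = 64p²`,
`N(E_p) = 32p²` (tree, modulo Modularity `exists_isNewformOf`), and `h(K′) < p` from `|d| < 6p` by Oesterlé's bound
`h ≤ π⁻¹√|d| log|d|` (tree `classNumber_lt_of_sqrt_mul_log_lt`) through the elementary inequality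
`π⁻¹ √x log x < p` for `70 < x < 6p` (`log y ≤ y/e` at `y = x^{1/4}`, tree `Lichtman2020.log_le_div_exp_one`), the range `|d| ≤ 70` being the tree's kernel
table `h ≤ 6`. Results:

* `cruxOnE2pCornerMod12_of_facts` — the card's `CruxOnE2pCornerMod12` VERBATIM (every prime `p ≡ 11 (mod 12)`: an explicit
  Heegner field `K′` of `N(E_{2p})` with `L(E_{2p}^{(d_{K′})}, 1) ≠ 0` and `h(K′) < p`), from FIVE NAMED FACTS as explicit
  binders: Modularity (`exists_isNewformOf`, for the conductor), Monsky's `2`-descent matrix theorem (even case),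
  Burungale–Tian's rank-zero `2`-converse for CM curves, Deuring–Hecke continuation, Burungale–Flach;
* `cruxOnEpCornerMod24_of_facts` — the card's `CruxOnEpCornerMod24` VERBATIM (odd case of Monsky's theorem).

So on the corners `W = E_{2p}` (`p ≡ 11 (mod 12)`) and `W = E_p` (`p ≡ 23 (mod 24)`) the CONCLUSION of the crux
`HeegnerTwistCouplingInSupply` holds outright modulo print, with an explicit witness field and no coupling theorem, no
density statement and no class-number divisibility input (the `h`-half is free by SIZE because the pin is `< 2p`). THEOREMS
ONLY; the crux itself (all CM `W` of analytic rank one, `p ≥ 5` inert and bad) is NOT proved — these are typed sub-corner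
rungs. Supports stmt-BirchSwinnertonDyer-21381.
-/

namespace Summit.BirchSwinnertonDyer.BirchSwinnertonDyer.Theorems.BiquadraticEisensteinDescentHeegnerTwistCouplingInSupplyThreeSquaresPinCorner

open Literature.NumberTheory.EllipticCurves Literature.NumberTheory.EllipticCurves.HeathBrown1994
  Summit.BirchSwinnertonDyer.BirchSwinnertonDyer.Theorems.BiquadraticEisensteinDescentHeegnerTwistCouplingInSupplyThreeSquaresPinRankZero
  Summit.BirchSwinnertonDyer.BirchSwinnertonDyer.Theorems.BiquadraticEisensteinDescentHeegnerTwistCouplingInSupplySizeIndivisibleSharp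

/-! ## §1 The size lever below `6p`: `π⁻¹ √x log x < p` for `70 < x < 6p` -/

/-- **The elementary inequality behind the size lever**: for real `x` with `70 < x < 6p`, `π⁻¹·√x·log x < p`.
Proof: with `y = x^{1/4}` (`y > 2.89` as `2.89⁴ < 70`), `√x log x = 4y² log y ≤ 4y³/e = 4x/(ey) < 24p/(ey)`, and
`e·π·y > 2.718·3.14·2.89 > 24`. [folklore] -/
theorem inv_pi_mul_sqrt_mul_log_lt {x : ℝ} {p : ℕ} (h70 : 70 < x) (hxp : x < 6 * p) :
    Real.pi⁻¹ * Real.sqrt x * Real.log x < p := by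
  have hx0 : 0 < x := by linarith
  set y : ℝ := Real.sqrt (Real.sqrt x) with hy
  have hsx0 : 0 < Real.sqrt x := Real.sqrt_pos.mpr hx0
  have hy0 : 0 < y := Real.sqrt_pos.mpr hsx0
  have hy2 : y ^ 2 = Real.sqrt x := Real.sq_sqrt hsx0.le
  have hy4 : y ^ 4 = x := by
    have : y ^ 4 = (y ^ 2) ^ 2 := by ring
    rw [this, hy2, Real.sq_sqrt hx0.le]
  have hlogx : Real.log x = 4 * Real.log y := by
    rw [← hy4, Real.log_pow]
    norm_num
  have hlogy : Real.log y ≤ y / Real.exp 1 := Literature.NumberTheory.Sieve.Lichtman2020.log_le_div_exp_one hy0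
  -- `y > 2.89`
  have hy_lb : (2.89 : ℝ) < y := by
    by_contra hle
    push Not at hle
    have h4 : y ^ 4 ≤ (2.89 : ℝ) ^ 4 := by
      exact pow_le_pow_left₀ hy0.le hle 4
    rw [hy4] at h4
    norm_num at h4
    linarith
  have hpi : (3.14 : ℝ) < Real.pi := Real.pi_gt_d2
  have he : (2.7182818283 : ℝ) < Real.exp 1 := Real.exp_one_gt_d9
  have hpi0 : 0 < Real.pi := Real.pi_pos
  have he0 : 0 < Real.exp 1 := Real.exp_pos 1
  -- `e π y > 24`
  have hkey : (24 : ℝ) < Real.exp 1 * Real.pi * y := by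
    have h1 : (2.7182818283 : ℝ) * 3.14 ≤ Real.exp 1 * Real.pi := by nlinarith
    nlinarith
  -- `4 y³ / e < π p`: multiply by `y > 0` and use `4 y⁴ = 4x < 24p ≤ e π y p`
  have hp0 : (0 : ℝ) < p := by
    have : (0 : ℝ) < 6 * p := by linarith
    linarith
  have h3 : 4 * y ^ 3 / Real.exp 1 < Real.pi * p := by
    rw [div_lt_iff₀ he0]
    -- `4 y³ < π p e`; multiply by `y`: `4 y⁴ < π p e y`, true since `4x < 24 p < e π y p`
    have h4 : 4 * y ^ 4 < Real.pi * p * Real.exp 1 * y := by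
      rw [hy4]
      nlinarith
    nlinarith
  -- assemble
  have hsq : Real.sqrt x = y ^ 2 := hy2.symm
  calc Real.pi⁻¹ * Real.sqrt x * Real.log x
      = Real.pi⁻¹ * (4 * y ^ 2 * Real.log y) := by rw [hsq, hlogx]; ring
    _ ≤ Real.pi⁻¹ * (4 * y ^ 3 / Real.exp 1) := by
        apply mul_le_mul_of_nonneg_left _ (inv_nonneg.mpr hpi0.le)
        have : 4 * y ^ 2 * Real.log y ≤ 4 * y ^ 2 * (y / Real.exp 1) :=
          mul_le_mul_of_nonneg_left hlogy (by positivity)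
        calc 4 * y ^ 2 * Real.log y ≤ 4 * y ^ 2 * (y / Real.exp 1) := this
          _ = 4 * y ^ 3 / Real.exp 1 := by ring
    _ < Real.pi⁻¹ * (Real.pi * p) := by
        apply mul_lt_mul_of_pos_left h3 (inv_pos.mpr hpi0)
    _ = p := by field_simp

/-- **`h(K′) < p` below `6p`**: an imaginary quadratic field `K′` with `4 < |d_{K′}| < 6p`, `p ≥ 11`, has `h(K′) < p` —
by the kernel table `|d| ≤ 70 ⇒ h ≤ 6` (tree) or, for `|d| > 70`, by Oesterlé's bound `h ≤ π⁻¹√|d| log|d|` (tree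
`classNumber_lt_of_sqrt_mul_log_lt`) and `inv_pi_mul_sqrt_mul_log_lt`. [cite: Oesterle1988Gauss, II §3 Proposition p. 57 (27)] -/
theorem classNumber_lt_of_natAbs_discr_lt_six_mul {K : Type*} [Field K] [NumberField K] (hK : IsImaginaryQuadratic K)
    (h4 : 4 < (NumberField.discr K).natAbs) {p : ℕ} (hp : 11 ≤ p) (hlt : (NumberField.discr K).natAbs < 6 * p) :
    NumberField.classNumber K < p := by
  by_cases h70 : (NumberField.discr K).natAbs ≤ 70
  · exact (classNumber_le_six_of_natAbs_discr_le hK h70).trans_lt (by omega)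
  · push Not at h70
    refine classNumber_lt_of_sqrt_mul_log_lt hK h4 (inv_pi_mul_sqrt_mul_log_lt ?_ ?_)
    · exact_mod_cast h70
    · exact_mod_cast hlt

/-! ## §2 The witness field `K′ = ℚ(√−3ℓ)` -/

/-- `3ℓ` is square-free for a prime `ℓ ≠ 3`. [folklore] -/
theorem squarefree_three_mul {l : ℕ} (hl : l.Prime) (hl3 : l ≠ 3) : Squarefree (3 * l) := by
  rw [Nat.squarefree_mul ((Nat.coprime_primes Nat.prime_three hl).mpr hl3.symm)]
  exact ⟨Nat.prime_three.squarefree, hl.squarefree⟩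

/-- The prime divisors of `64 p²` are `2` and `p`. [folklore] -/
theorem eq_two_or_eq_of_prime_dvd_sixtyFour_mul_sq {p q : ℕ} (hp : p.Prime) (hq : q.Prime) (h : q ∣ 64 * p ^ 2) :
    q = 2 ∨ q = p := by
  rcases (Nat.Prime.dvd_mul hq).mp h with h | h
  · left
    have h64 : (64 : ℕ) = 2 ^ 6 := by norm_num
    rw [h64] at h
    exact (Nat.prime_dvd_prime_iff_eq hq Nat.prime_two).mp (hq.dvd_of_dvd_pow h)
  · right
    exact (Nat.prime_dvd_prime_iff_eq hq hp).mp (hq.dvd_of_dvd_pow h)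

/-- The prime divisors of `32 p²` are `2` and `p`. [folklore] -/
theorem eq_two_or_eq_of_prime_dvd_thirtyTwo_mul_sq {p q : ℕ} (hp : p.Prime) (hq : q.Prime) (h : q ∣ 32 * p ^ 2) :
    q = 2 ∨ q = p := by
  rcases (Nat.Prime.dvd_mul hq).mp h with h | h
  · left
    have h32 : (32 : ℕ) = 2 ^ 5 := by norm_num
    rw [h32] at h
    exact (Nat.prime_dvd_prime_iff_eq hq Nat.prime_two).mp (hq.dvd_of_dvd_pow h)
  · right
    exact (Nat.prime_dvd_prime_iff_eq hq hp).mp (hq.dvd_of_dvd_pow h)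

/-- **The witness field for the pin.** For primes `p ≥ 11` (odd) and `ℓ ≡ 5 (mod 8)` with `(−3ℓ/p) = +1` and
`3ℓ < 6p`: `K′ = ℚ(√−3ℓ)` is imaginary quadratic with `d_{K′} = −3ℓ`, satisfies the Heegner hypothesis for every level
`N` whose prime divisors are among `{2, p}`, and `h(K′) < p`. [cite: Marcus2018, Ch. 2 Thm. 1; Ch. 3 Thm. 25]
[cite: Oesterle1988Gauss, II §3 Proposition p. 57 (27)] -/
theorem exists_witnessField {p l : ℕ} (hp : p.Prime) (hp11 : 11 ≤ p) (hl : l.Prime) (hl8 : l % 8 = 5)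
    (hJ3 : jacobiSym (-(3 * (l : ℤ))) p = 1) (hsz : 3 * l < 6 * p) {N : ℕ}
    (hN : ∀ q : ℕ, q.Prime → q ∣ N → q = 2 ∨ q = p) :
    ∃ (K : Type) (_ : Field K) (_ : NumberField K),
      IsImaginaryQuadratic K ∧ NumberField.discr K = -((3 * l : ℕ) : ℤ) ∧
      SatisfiesHeegnerHypothesis N K ∧ NumberField.classNumber K < p := by
  haveI : Fact ((-((3 * l : ℕ) : ℤ)) < 0) := ⟨by have := hl.two_le; omega⟩
  have hl3 : l ≠ 3 := by
    rintro rfl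
    omega
  have hsf : Squarefree (-((3 * l : ℕ) : ℤ)).natAbs := by
    rw [Int.natAbs_neg, Int.natAbs_natCast]
    exact squarefree_three_mul hl hl3
  have hD8 : (-((3 * l : ℕ) : ℤ)) % 8 = 1 := by omega
  obtain ⟨hK, hdK⟩ := isImaginaryQuadratic_and_discr_sqrtField_of_squarefree_natAbs (-((3 * l : ℕ) : ℤ))
    (by omega) hsf
  have hJ3' : jacobiSym (-((3 * l : ℕ) : ℤ)) p = 1 := by
    have : (-((3 * l : ℕ) : ℤ)) = -(3 * (l : ℤ)) := by push_cast; ring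
    rw [this]
    exact hJ3
  refine ⟨sqrtField (-((3 * l : ℕ) : ℤ)), inferInstance, inferInstance, hK, hdK, ?_, ?_⟩
  · refine satisfiesHeegnerHypothesis_sqrtField_of_squarefree_natAbs _ hD8 hsf fun q hq hqN => ?_
    rcases hN q hq hqN with rfl | rfl
    · exact Or.inl rfl
    · exact Or.inr hJ3'
  · refine classNumber_lt_of_natAbs_discr_lt_six_mul hK ?_ hp11 ?_
    · rw [hdK, Int.natAbs_neg, Int.natAbs_natCast]
      have := hl.two_le
      omega
    · rw [hdK, Int.natAbs_neg, Int.natAbs_natCast]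
      exact hsz

/-! ## §3 The corner theorems of the card, modulo five named facts -/

/-- **`CruxOnE2pCornerMod12` (card `three-squares-heegner-pin`, signature VERBATIM from `SketchIdeasSeat2G14.lean`),
PROVED modulo Modularity + Monsky (even) + Burungale–Tian + Deuring–Hecke + Burungale–Flach.** For every prime
`p ≡ 11 (mod 12)`: the three-squares pin `ℓ` and the Heegner field `K′ = ℚ(√−3ℓ)` of `N(E_{2p}) = 64p²` with
`L(E_{2p}^{(−3ℓ)}, 1) ≠ 0` and `h(K′) < p` — the conclusion of `HeegnerTwistCouplingInSupply` on the corner `W = E_{2p}`.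
[cite: HeathBrown1994SelmerCongruentII, Appendix (Monsky), typescript p. 41 L20–L36] [cite: BurungaleTian2026, Thm. 1.1]
[cite: BurungaleFlach2024, Thm. 1.1 and Cor. 2] [cite: KoblitzECMF1993, Ch. II §5, Theorem (p. 84)] -/
theorem cruxOnE2pCornerMod12_of_facts (hmod : ModularForms.exists_isNewformOf) (hM : monsky_card_selmerGroup_two_even)
    (hBT : burungaleTian_analyticRank_eq_zero_of_selmerCorank_eq_zero_of_hasCM)
    (hH : hasEntireLFunction_of_j_mem_maximalCMJInvariants) (hBF : bsdTriple_of_hasCM_of_L_one_ne_zero) :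
    ∀ (p : ℕ) [Fact p.Prime] [(congruentNumberCurve (2 * p)).IsElliptic]
      [(congruentNumberCurve (2 * p)).IsGloballyMinimal]
      [NeZero ((congruentNumberCurve (2 * p)).conductorNorm ℤ)],
      p % 12 = 11 →
      ∃ (ℓ : ℕ) (K : Type) (_ : Field K) (_ : NumberField K),
        ℓ.Prime ∧ ℓ < 2 * p ∧ ℓ % 8 = 5 ∧ jacobiSym (ℓ : ℤ) p = -1 ∧
        IsImaginaryQuadratic K ∧ NumberField.discr K = -((3 * ℓ : ℕ) : ℤ) ∧
        SatisfiesHeegnerHypothesis ((congruentNumberCurve (2 * p)).conductorNorm ℤ) K ∧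
        ((congruentNumberCurve (2 * p)).quadraticTwist (NumberField.discr K : ℚ)).entireLFunction 1 ≠ 0 ∧
        NumberField.classNumber K < p := by
  intro p hpF _ _ _ hp12
  have hp : p.Prime := hpF.out
  obtain ⟨ℓ, hℓ, hlt, hℓ8, hJ, -, hJ3, hsz, -, -, -, hL⟩ := exists_pin_analyticRank_eq_zero_two_p hM hBT hH hBF hp hp12
  -- the conductor `N(E_{2p}) = 64 p²`
  have hsq2p : Squarefree (2 * p) := by
    rw [Nat.squarefree_mul ((Nat.coprime_primes Nat.prime_two hp).mpr (by omega))]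
    exact ⟨Nat.prime_two.squarefree, hp.squarefree⟩
  have hN : (congruentNumberCurve (2 * p)).conductorNorm ℤ = 64 * p ^ 2 :=
    (rootNumber_eq_and_conductorNorm_congruentNumberCurve_two_mul hmod hsq2p).2
  obtain ⟨K, iF, iN, hK, hdK, hH', hh⟩ := exists_witnessField (N := (congruentNumberCurve (2 * p)).conductorNorm ℤ)
    hp (by omega) hℓ hℓ8 hJ3 hsz (fun q hq hqN => eq_two_or_eq_of_prime_dvd_sixtyFour_mul_sq hp hq (hN ▸ hqN))
  refine ⟨ℓ, K, iF, iN, hℓ, hlt, hℓ8, hJ, hK, hdK, hH', ?_, hh⟩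
  rw [hdK, quadraticTwist_congruentNumberCurve, Int.natAbs_neg, Int.natAbs_natCast]
  exact hL

/-- **`CruxOnEpCornerMod24` (card `three-squares-heegner-pin`, signature VERBATIM from `SketchIdeasSeat2G14.lean`),
PROVED modulo Modularity + Monsky (odd) + Burungale–Tian + Deuring–Hecke + Burungale–Flach.** For every prime
`p ≡ 23 (mod 24)`: the pin `ℓ` and the Heegner field `K′ = ℚ(√−3ℓ)` of `N(E_p) = 32p²` with `L(E_p^{(−3ℓ)}, 1) ≠ 0` and
`h(K′) < p`. [cite: HeathBrown1994SelmerCongruentII, Appendix (Monsky), typescript p. 39 L27–L33] [cite: BurungaleTian2026, Thm. 1.1]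
[cite: BurungaleFlach2024, Thm. 1.1 and Cor. 2] [cite: KoblitzECMF1993, Ch. II §5, Theorem (p. 84)] -/
theorem cruxOnEpCornerMod24_of_facts (hmod : ModularForms.exists_isNewformOf) (hM : monsky_card_selmerGroup_two_odd)
    (hBT : burungaleTian_analyticRank_eq_zero_of_selmerCorank_eq_zero_of_hasCM)
    (hH : hasEntireLFunction_of_j_mem_maximalCMJInvariants) (hBF : bsdTriple_of_hasCM_of_L_one_ne_zero) :
    ∀ (p : ℕ) [Fact p.Prime] [(congruentNumberCurve p).IsElliptic]
      [(congruentNumberCurve p).IsGloballyMinimal] [NeZero ((congruentNumberCurve p).conductorNorm ℤ)],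
      p % 24 = 23 →
      ∃ (ℓ : ℕ) (K : Type) (_ : Field K) (_ : NumberField K),
        ℓ.Prime ∧ ℓ < 2 * p ∧ ℓ % 8 = 5 ∧ jacobiSym (ℓ : ℤ) p = -1 ∧
        IsImaginaryQuadratic K ∧ NumberField.discr K = -((3 * ℓ : ℕ) : ℤ) ∧
        SatisfiesHeegnerHypothesis ((congruentNumberCurve p).conductorNorm ℤ) K ∧
        ((congruentNumberCurve p).quadraticTwist (NumberField.discr K : ℚ)).entireLFunction 1 ≠ 0 ∧
        NumberField.classNumber K < p := by
  intro p hpF _ _ _ hp24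
  have hp : p.Prime := hpF.out
  obtain ⟨ℓ, hℓ, hlt, hℓ8, hJ, -, hJ3, hsz, -, -, -, hL⟩ := exists_pin_analyticRank_eq_zero_p hM hBT hH hBF hp hp24
  -- the conductor `N(E_p) = 32 p²`
  have hN : (congruentNumberCurve p).conductorNorm ℤ = 32 * p ^ 2 :=
    conductorNorm_congruentNumberCurve_of_odd hmod hp.squarefree (Nat.odd_iff.mpr (by omega))
  obtain ⟨K, iF, iN, hK, hdK, hH', hh⟩ := exists_witnessField (N := (congruentNumberCurve p).conductorNorm ℤ)
    hp (by omega) hℓ hℓ8 hJ3 hsz (fun q hq hqN => eq_two_or_eq_of_prime_dvd_thirtyTwo_mul_sq hp hq (hN ▸ hqN))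
  refine ⟨ℓ, K, iF, iN, hℓ, hlt, hℓ8, hJ, hK, hdK, hH', ?_, hh⟩
  rw [hdK, quadraticTwist_congruentNumberCurve, Int.natAbs_neg, Int.natAbs_natCast]
  exact hL

end Summit.BirchSwinnertonDyer.BirchSwinnertonDyer.Theorems.BiquadraticEisensteinDescentHeegnerTwistCouplingInSupplyThreeSquaresPinCorner
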